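import Summits.CriticalPhenomena.PercolationContinuityZ3.Theorems.PercNearOneGluingNoHeavyLowerTailSunflowerTypeModelPaths
import HarnessLib

/-!
# `NoHeavyLowerTail` (crux stmt-CriticalPhenomena-4575), abstract sunflower cubic: TYPE MODEL, part 2 — the model, statuses
# A / P / Z, BAD and GOOD configurations, and PLANS (canonical Hamiltonian paths of the orientation on the non-A slots)

Support file (seat `prim-ineq-prove-1` gen 40; `--supports stmt-CriticalPhenomena-4575`).  No `sorry`, no named facts.  Memo:
run/shared/lean/prim/prim-ineq-prove-1/FINDING-BIPARTITE-prove1-g40.md (§3 the type model, §4 the injection Ψ).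

THE PROGRAMME.  THEOREM (memo): every BIPARTITE graph core `edgeCore Γ` is A-safe (Lemma A for every number of petals and every
product measure).  Polarisation + symmetrisation + conditioning on one side of the bipartition reduce it to the purely finite
TYPE-MODEL LEMMA `TypeModel.Model.typeModel_lemma` (file `…SunflowerTypeModelLemma`): for K slots, elements with killer types
`τ x ⊆ [K]` and multiplicities, petal labels and an orientation digraph `O`, one has, for every multiplicity profile,
`Σ_{BAD S} (K − |nonA S|)! ≤ (K−1)!·#GOOD`.  The proof is an explicit injection `(S, enumeration) ↦ (Ψ S, key)`: rotate the contents
of the non-A slots along a Hamiltonian path of `O|_N` whose start dominates its end (else its last-but-one), strip the new Z-slot,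
and encode the path reversed in front of the enumeration.

THIS FILE (part 2).  `TypeModel.Model` (killer types `τ`, labels, orientation `O` with an arc between slots of distinct labels);
for a configuration `S : ι → Finset (Fin K)` (the slot set of each element): `HasWit`, `IsA` (a slot holding one of its own
killers), `IsP` (no killer, a label, witnesses for all in-neighbours), `nonA`, `Bad`, `Good`; `semicomplete_of_bad`.
`Model.Plan N`: a Hamiltonian path `u :: mid ++ w :: v.toList` of `O|_N` with `O u w` (`v = none`: type I, start → end; `v = some z`:
type II, start → last-but-one), with the API `path`, `z` (end), `pen` (last-but-one), `pen2`, the rotation `rho = formPerm path.reverse`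
(`rho_u : ρ u = z`, `rho_z : ρ z = pen`, `rho_pen_of_typeII`, `rho_of_notMem`), the arcs `O_pen_z`, `O_u_z_of_typeI`,
`O_u_pen_of_typeII`, and `exists_succ` (every path vertex `≠ z` is `ρ` of its successor, which it dominates).
-/

namespace Summit.CriticalPhenomena.PercolationContinuityZ3.Theorems.SunflowerPartition

namespace TypeModel

open Finset Literature.Combinatorics.Digraph

variable {K : ℕ} {ι : Type*} {Λ : Type*}


/-- The abstract **type model** with `K` slots (g40 memo §3): elements `x : ι` carry a KILLER TYPE `τ x ⊆ [K]`
(`k ∈ τ x` iff `x ∈ F_k`); slots carry petal LABELS (`none` = no petal section); `O` is the ORIENTATION digraph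
with at least one arc between two slots of distinct labels. [this work] -/
structure Model (K : ℕ) (ι Λ : Type*) where
  /-- killer type of an element -/
  τ : ι → Finset (Fin K)
  /-- petal label of a slot (`none`: the slot has no petal section) -/
  lab : Fin K → Option Λ
  /-- orientation: `O l k` means every petal-set of slot `k` must contain an `F_l`-element -/
  O : Fin K → Fin K → Prop
  [decO : DecidableRel O]
  /-- slots with distinct (present) labels are joined by an arc -/
  arc : ∀ k l, k ≠ l → lab k ≠ none → lab l ≠ none → lab k ≠ lab l → O k l ∨ O l k

attribute [instance] Model.decO

namespace Model

variable (M : Model K ι Λ)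

variable (S : ι → Finset (Fin K))

/-- Slot `k` holds an element of type `∋ l` (an `F_l`-element). [this work] -/
def HasWit (k l : Fin K) : Prop := ∃ x, k ∈ S x ∧ l ∈ M.τ x

/-- Slot `k` is an **A-slot**: it holds one of its own killers. [this work] -/
def IsA (k : Fin K) : Prop := M.HasWit S k k

/-- Slot `k` is a **P-slot** ("petal"): no killer, a label, and witnesses for every in-neighbour in `O`. [this work] -/
def IsP (k : Fin K) : Prop := ¬ M.IsA S k ∧ M.lab k ≠ none ∧ ∀ l, M.O l k → M.HasWit S k l

/-- The set `N` of non-A slots. [this work] -/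
noncomputable def nonA : Finset (Fin K) := by
  classical exact univ.filter fun k => ¬ M.IsA S k

/-- **BAD** configuration: at least two non-A slots, all of them petal slots with pairwise distinct labels.
[this work] -/
def Bad : Prop :=
  2 ≤ (M.nonA S).card ∧ (∀ k ∈ M.nonA S, M.IsP S k) ∧
    ∀ k ∈ M.nonA S, ∀ l ∈ M.nonA S, k ≠ l → M.lab k ≠ M.lab l

/-- **GOOD** configuration: exactly one non-A slot, and it is not a petal slot (a "Z-slot"). [this work] -/
def Good : Prop := ∃ z, M.nonA S = {z} ∧ ¬ M.IsP S z

/-- Membership in the non-A set. [this work] -/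
theorem mem_nonA {k : Fin K} : k ∈ M.nonA S ↔ ¬ M.IsA S k := by
  classical
  unfold nonA; simp

/-- In a BAD configuration the orientation is semicomplete on the non-A slots. [this work] -/
theorem semicomplete_of_bad (hS : M.Bad S) : Semicomplete M.O (M.nonA S) := by
  intro k hk l hl hkl
  exact M.arc k l hkl (hS.2.1 k hk).2.1 (hS.2.1 l hl).2.1 (hS.2.2 k hk l hl hkl)

/-! ### The canonical plan of a set of slots -/

/-- A PLAN for the slot set `N`: a Hamiltonian path `u, mid…, w[, v]` of `O|_N` whose start `u` dominates `w`;
`v = none` is TYPE I (the path ends at `w = z`, start → end), `v = some z` is TYPE II (start → penultimate).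
[this work] -/
structure Plan (N : Finset (Fin K)) where
  /-- start `k₁` -/
  u : Fin K
  /-- interior -/
  mid : List (Fin K)
  /-- the dominated vertex: the end (type I) or the penultimate (type II) -/
  w : Fin K
  /-- type II: the end -/
  v : Option (Fin K)
  ham : IsHamPath M.O N (u :: (mid ++ (w :: v.toList)))
  dom : M.O u w

variable {M S}

namespace Plan

variable {N : Finset (Fin K)} (P : M.Plan N)

/-- the path as a list -/
def path : List (Fin K) := P.u :: (P.mid ++ (P.w :: P.v.toList))

/-- the end `z` of the path (the future Z-slot) -/
def z : Fin K := P.v.getD P.w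

/-- the slot `k_{s-1}` just before `z` (receives `T_z` and the `F_z`-dump) -/
def pen : Fin K := match P.v with
  | none => (P.u :: P.mid).getLast (List.cons_ne_nil _ _)
  | some _ => P.w

/-- the slot `k_{s-2}` (type II only; receives the `F_{k_{s-1}}`-dump) -/
def pen2 : Fin K := (P.u :: P.mid).getLast (List.cons_ne_nil _ _)

/-- the rotation `ρ`: `k_{i+1} ↦ k_i`, `k_1 ↦ z`, identity off the path -/
def rho [DecidableEq (Fin K)] : Equiv.Perm (Fin K) := List.formPerm P.path.reverse

/-- The path ends at `z`. [this work] -/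
theorem path_eq_append_z : P.path = (P.u :: (P.mid ++ (match P.v with | none => [] | some _ => [P.w]))) ++ [P.z] := by
  unfold path z; cases P.v <;> simp

/-- The path has no repetition. [this work] -/
theorem nodup_path : P.path.Nodup := P.ham.nodup

/-- The path lists exactly `N`. [this work] -/
theorem mem_path_iff {k : Fin K} : k ∈ P.path ↔ k ∈ N := P.ham.mem_iff k

/-- `z ∈ N`. [this work] -/
theorem z_mem : P.z ∈ N := by
  rw [← P.mem_path_iff, path_eq_append_z]; simp

/-- `u ∈ N`. [this work] -/
theorem u_mem : P.u ∈ N := by rw [← P.mem_path_iff]; unfold path; simp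

/-- `ρ u = z`. [this work] -/
theorem rho_u : P.rho P.u = P.z := by
  unfold rho
  rw [show P.path = P.u :: (P.mid ++ (P.w :: P.v.toList)) from rfl, formPerm_reverse_apply_head]
  unfold z; cases P.v <;> simp

/-- `ρ` fixes slots outside `N`. [this work] -/
theorem rho_of_notMem {k : Fin K} (hk : k ∉ N) : P.rho k = k := by
  unfold rho; exact formPerm_reverse_apply_of_notMem (by rwa [P.mem_path_iff])

/-- `pen` immediately precedes `z` on the path. -/
theorem path_eq_pen_z : ∃ L : List (Fin K), P.path = L ++ [P.pen, P.z] := by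
  unfold path pen z
  rcases hv : P.v with _ | v
  · rcases List.eq_nil_or_concat P.mid with h0 | ⟨L, b, hb⟩
    · refine ⟨[], ?_⟩; simp [h0]
    · replace hb : P.mid = L ++ [b] := by simpa using hb
      refine ⟨P.u :: L, ?_⟩; simp [hb]
  · exact ⟨P.u :: P.mid, by simp⟩

/-- `ρ z = pen`. [this work] -/
theorem rho_z : P.rho P.z = P.pen := by
  obtain ⟨L, hL⟩ := P.path_eq_pen_z
  unfold rho; rw [hL]
  have hnd : (L ++ P.pen :: P.z :: []).Nodup := by rw [← hL]; exact P.nodup_path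
  exact formPerm_reverse_apply_next hnd

/-- type II: `pen2` immediately precedes `pen = w` on the path. -/
theorem path_eq_pen2_pen_z {v : Fin K} (hv : P.v = some v) :
    ∃ L : List (Fin K), P.path = L ++ [P.pen2, P.pen, P.z] := by
  unfold path pen pen2 z
  rw [hv]
  rcases List.eq_nil_or_concat P.mid with h0 | ⟨L, b, hb⟩
  · refine ⟨[], ?_⟩; simp [h0]
  · replace hb : P.mid = L ++ [b] := by simpa using hb
    refine ⟨P.u :: L, ?_⟩; simp [hb]

/-- Type II: `ρ pen = pen2`. [this work] -/
theorem rho_pen_of_typeII {v : Fin K} (hv : P.v = some v) : P.rho P.pen = P.pen2 := by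
  obtain ⟨L, hL⟩ := P.path_eq_pen2_pen_z hv
  unfold rho; rw [hL]
  have hnd : (L ++ P.pen2 :: P.pen :: [P.z]).Nodup := by rw [← hL]; exact P.nodup_path
  exact formPerm_reverse_apply_next hnd

/-- `O pen z` (a path arc). -/
theorem O_pen_z : M.O P.pen P.z := by
  obtain ⟨L, hL⟩ := P.path_eq_pen_z
  have h := P.ham.chain
  rw [show P.u :: (P.mid ++ (P.w :: P.v.toList)) = P.path from rfl, hL] at h
  exact rel_of_isChain_append_cons_cons (L' := []) h

/-- type I: `u ∈ In(z)` i.e. `O u z`. -/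
theorem O_u_z_of_typeI (hv : P.v = none) : M.O P.u P.z := by
  unfold z; rw [hv]; simpa using P.dom

/-- type II: `O u pen`. -/
theorem O_u_pen_of_typeII {v : Fin K} (hv : P.v = some v) : M.O P.u P.pen := by
  unfold pen; rw [hv]; simpa using P.dom

/-- `pen ∈ N`. [this work] -/
theorem pen_mem : P.pen ∈ N := by
  obtain ⟨L, hL⟩ := P.path_eq_pen_z
  rw [← P.mem_path_iff, hL]; simp

/-- Type II: `pen2 ∈ N`. [this work] -/
theorem pen2_mem_of_typeII {v : Fin K} (hv : P.v = some v) : P.pen2 ∈ N := by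
  obtain ⟨L, hL⟩ := P.path_eq_pen2_pen_z hv
  rw [← P.mem_path_iff, hL]; simp

/-- `pen ≠ z`. [this work] -/
theorem pen_ne_z : P.pen ≠ P.z := by
  obtain ⟨L, hL⟩ := P.path_eq_pen_z
  have hnd := P.nodup_path; rw [hL] at hnd
  intro h
  have := List.nodup_append.1 hnd |>.2.1
  simp [h] at this

/-- Type II: `pen2 ≠ z`. [this work] -/
theorem pen2_ne_z_of_typeII {v : Fin K} (hv : P.v = some v) : P.pen2 ≠ P.z := by
  obtain ⟨L, hL⟩ := P.path_eq_pen2_pen_z hv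
  have hnd := P.nodup_path; rw [hL] at hnd
  intro h
  have := List.nodup_append.1 hnd |>.2.1
  simp [h] at this

/-- Every path vertex other than `z` has a successor `k'` with `ρ k' = k` and `O k k'`. -/
theorem exists_succ {k : Fin K} (hk : k ∈ N) (hkz : k ≠ P.z) :
    ∃ k', k' ∈ N ∧ P.rho k' = k ∧ M.O k k' := by
  have hkl : k ∈ P.path := P.mem_path_iff.2 hk
  have hlast : ∀ h : P.path ≠ [], k ≠ P.path.getLast h := by
    intro h
    have e : P.path.getLast h = P.z := by
      simp only [P.path_eq_append_z, List.getLast_append_of_ne_nil _ (List.cons_ne_nil _ _),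
        List.getLast_singleton]
    rw [e]; exact hkz
  obtain ⟨L, L', k', hL⟩ := exists_next_of_ne_getLast hkl hlast
  refine ⟨k', ?_, ?_, ?_⟩
  · rw [← P.mem_path_iff, hL]; simp
  · unfold rho; rw [hL]
    have hnd : (L ++ k :: k' :: L').Nodup := by rw [← hL]; exact P.nodup_path
    exact formPerm_reverse_apply_next hnd
  · have h := P.ham.chain
    rw [show P.u :: (P.mid ++ (P.w :: P.v.toList)) = P.path from rfl, hL] at h
    exact rel_of_isChain_append_cons_cons h

end Plan

end Model

end TypeModel

end Summit.CriticalPhenomena.PercolationContinuityZ3.Theorems.SunflowerPartition
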